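import Mathlib
import Summits.ValiantsHypothesis.ValiantsHypothesis.Theorems.BarrierLeverPartitionMinorsHitByVPHiddenStatesCoHubLift
import Summits.ValiantsHypothesis.ValiantsHypothesis.Theorems.BarrierLeverPartitionMinorsHitByVPHiddenStatesStarJoins
import Summits.ValiantsHypothesis.ValiantsHypothesis.Theorems.BarrierLeverPartitionMinorsHitByVPHiddenStatesHubWideLower

/-!
# Route BarrierLever — item `PartitionMinorsHitByVP` (stmt-ValiantsHypothesis-19717), line `hidden-states`:
# THE CO-HUB THEOREM — the LOWER node at `(h, 2^h − c)` for EVERY `h` and EVERY `1 ≤ c ≤ 2h³ − 2h + 2`;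
# the `h = 19` window of the lower node is CLOSED

Helper file (`--supports stmt-ValiantsHypothesis-19717`; cell valiant-natproofs, rung V4, 𝒟-side door (c), registered line
`Cruxes/PartitionMinorsHitByVP/Lines/hidden_states.lean` v8; prover seat val-np-p6 gen 14). Definition-free; closes NO item.
Sequel of `…HiddenStatesDoublingFree` (symbolic core-free doubling) and `…HiddenStatesCoHubLift` (`CoHub.coHub_lift`).

THE CONSTRUCTION. Fix `c ≥ 1` and let `n₀ = ⌊log₂ c⌋ + 1` be the first level with `2^{n₀} > c`. BASE: at level `n₀` the cell has
`r₀ = 2^{n₀} − c ≤ c` rows and is served for ALL injective families by TWO star pieces (`StarJoin.starJoin_good`, p578997).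
STEP: `CoHub.coHub_lift` with `s = 2` fresh star pieces per level (doubled old design ⊔ `c` free points). After `h − n₀` steps:
`2 + 2(h − n₀) ≤ 2h` pieces and `(h³ − h) + (h − n₀) ≤ h³` states, provided the `c` free points fit into two stars on
`h³ − h` states, i.e. `c ≤ 2(h³ − h) + 2`. This is the top-of-the-cube mirror image of the HUB range at the bottom
(`HubWide.universalJoinWide_of_le_hub`, `r ≤ 2h⁴ + O(h³)`): a POLYNOMIAL top window, where the tree had the LINEAR window
`c ≤ h + 1` (ball diagonal, p634848) and `c ≤ 20` (core lift / tilt cells).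

* `coHub_iter` — the lift iterated `d` times from any explicit-budget design at level `n₀` (`m ↦ m + 2d`, `K ↦ K + d`).
* **`universalJoinWideLower_coHub`** — the body of `LowerNode.Stmt.universalJoinWideLower` (p599518) at `(h, 2^h − c)` for every
  `h` and every `c` with `1 ≤ c < 2^h` and `c + 2h ≤ 2h³ + 2`.
* **`universalJoinWideLower_nineteen_all`** — `h = 19`: the lower node body for EVERY `r ≤ 2^19` (hub/degree range `r ≤ 517 158`,
  p611381, needs co-size `≥ 7 130`; the co-hub gives every co-size `≤ 13 682`). **`universalJoinWideLower_upto_nineteen`** — every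
  `1 ≤ h ≤ 19`, every `r ≤ 2^h`. The first open cell of the LOWER node moves to `h = 20` (`coHub_window_twenty`: `r ≥ 1 032 614` served).

WHAT THIS IS NOT: the method pays `c` free points per dimension and cannot leave the polynomial top window; the bulk
`≈ 4h⁴ < r < 2^h − 2h³` of the node (conjecture GC½ and below) is untouched; the registered stubs (`∃ h₁ ∀ h ≥ h₁ ∀ r`) are not
closed; nothing on crux 14610 or VP ≠ VNP.
-/

set_option linter.dupNamespace false

namespace Summit.ValiantsHypothesis.ValiantsHypothesis.Theorems.BarrierLever.HiddenStates

open Finset Matrix MvPolynomial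

noncomputable section

namespace CoHub

/-- **Iterated co-hub lift.** An explicit-budget design (`m` pieces, `K` states) serving every lower family of the cell
`(n₀, 2^{n₀} − c)`, with `1 ≤ c < 2^{n₀}` and `c ≤ 2(K + 2)`, yields one with `m + 2d` pieces and `K + d` states for the cell
`(n₀ + d, 2^{n₀+d} − c)`, for every `d`. -/
theorem coHub_iter (n₀ c m K : ℕ) (hn₀ : c < 2 ^ n₀) (hcK : c ≤ 2 * (K + 2))
    (H : ∃ (W : Fin m → ℕ) (wt : Fin m → Fin K → ℕ) (e : Fin (2 ^ n₀ - c) → Fin m × Finset (Fin K)),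
      Function.Injective e ∧
      (∀ x : Fin m × Finset (Fin K), x ∉ Set.range e →
        ∀ i, W (e i).1 + ∑ k ∈ (e i).2, wt (e i).1 k < W x.1 + ∑ k ∈ x.2, wt x.1 k) ∧
      ∀ u : Fin (2 ^ n₀ - c) → Finset (Fin n₀), Function.Injective u → IsLowerSet (Set.range u) →
        ∃ tx : Fin m → Option (Fin K) → Fin n₀ → ℂ,
          (Matrix.of fun i k : Fin (2 ^ n₀ - c) =>
            ∏ a ∈ u i, (tx (e k).1 none a + ∑ q ∈ (e k).2, tx (e k).1 (some q) a)).det ≠ 0) (d : ℕ) :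
    ∃ (W : Fin (m + 2 * d) → ℕ) (wt : Fin (m + 2 * d) → Fin (K + d) → ℕ)
      (e : Fin (2 ^ (n₀ + d) - c) → Fin (m + 2 * d) × Finset (Fin (K + d))),
      Function.Injective e ∧
      (∀ x : Fin (m + 2 * d) × Finset (Fin (K + d)), x ∉ Set.range e →
        ∀ i, W (e i).1 + ∑ k ∈ (e i).2, wt (e i).1 k < W x.1 + ∑ k ∈ x.2, wt x.1 k) ∧
      ∀ u : Fin (2 ^ (n₀ + d) - c) → Finset (Fin (n₀ + d)), Function.Injective u → IsLowerSet (Set.range u) →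
        ∃ tx : Fin (m + 2 * d) → Option (Fin (K + d)) → Fin (n₀ + d) → ℂ,
          (Matrix.of fun i k : Fin (2 ^ (n₀ + d) - c) =>
            ∏ a ∈ u i, (tx (e k).1 none a + ∑ q ∈ (e k).2, tx (e k).1 (some q) a)).det ≠ 0 := by
  induction d with
  | zero => simpa using H
  | succ d ih =>
    have hpow : 2 ^ n₀ ≤ 2 ^ (n₀ + d) := Nat.pow_le_pow_right (by norm_num) (by omega)
    have hr : 2 ^ (n₀ + (d + 1)) - c = (2 ^ (n₀ + d) - c) + (2 ^ (n₀ + d) - c) + c := by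
      rw [show n₀ + (d + 1) = (n₀ + d) + 1 by omega, pow_succ]; omega
    rw [hr, show m + 2 * (d + 1) = (m + 2 * d) + 2 by ring, show K + (d + 1) = (K + d) + 1 by ring,
      show n₀ + (d + 1) = (n₀ + d) + 1 by ring]
    exact coHub_lift (n₀ + d) c (m + 2 * d) (K + d) (2 ^ (n₀ + d) - c) 2 (by omega) (by omega) (by omega) ih

/-- **THE CO-HUB THEOREM.** For every `h` and every co-size `c` with `1 ≤ c < 2^h` and `c + 2h ≤ 2h³ + 2`, the body of
`LowerNode.Stmt.universalJoinWideLower` holds at `(h, 2^h − c)`: ONE legal wide join design (`≤ 2h` pieces, `≤ h³` states) whose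
block-additive matrix is nonsingular at some table for EVERY injective row family with lower-set range. -/
theorem universalJoinWideLower_coHub (h c : ℕ) (hc1 : 1 ≤ c) (hch : c < 2 ^ h) (hcK : c + 2 * h ≤ 2 * (h * h * h) + 2) :
    ∃ (m K : ℕ) (W : Fin m → ℕ) (wt : Fin m → Fin K → ℕ) (e : Fin (2 ^ h - c) → Fin m × Finset (Fin K)),
      m ≤ h + h ∧ K ≤ h * h * h ∧ Function.Injective e ∧
      (∀ x : Fin m × Finset (Fin K), x ∉ Set.range e →
        ∀ i, W (e i).1 + ∑ k ∈ (e i).2, wt (e i).1 k < W x.1 + ∑ k ∈ x.2, wt x.1 k) ∧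
      ∀ u : Fin (2 ^ h - c) → Finset (Fin h), Function.Injective u → IsLowerSet (Set.range u) →
        ∃ tx : Fin m → Option (Fin K) → Fin h → ℂ,
          (Matrix.of fun i k : Fin (2 ^ h - c) =>
            ∏ a ∈ u i, (tx (e k).1 none a + ∑ q ∈ (e k).2, tx (e k).1 (some q) a)).det ≠ 0 := by
  -- the first level above `c`
  set n₀ : ℕ := Nat.log 2 c + 1 with hn₀def
  have hc0 : c ≠ 0 := by omega
  have hn₀c : c < 2 ^ n₀ := Nat.lt_pow_succ_log_self (by norm_num) c
  have hcn₀ : 2 ^ n₀ ≤ 2 * c := by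
    rw [hn₀def, pow_succ]; have := Nat.pow_log_le_self 2 hc0; omega
  have hn₀h : n₀ ≤ h := by
    have := Nat.log_lt_of_lt_pow hc0 hch; omega
  have hn₀1 : 1 ≤ n₀ := by omega
  have h1 : 1 ≤ h := le_trans hn₀1 hn₀h
  have hhh : h ≤ h * h * h := by
    calc h = h * 1 * 1 := by ring
      _ ≤ h * h * h := Nat.mul_le_mul (Nat.mul_le_mul le_rfl h1) h1
  obtain ⟨d, hd⟩ : ∃ d, h = n₀ + d := ⟨h - n₀, by omega⟩
  -- base: two stars on `h³ − h` states serve the `2^{n₀} − c ≤ c` rows at level `n₀`, for ALL injective families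
  obtain ⟨W, wt, e, he, hthr, hgood⟩ :=
    StarJoin.starJoin_good n₀ 2 (h * h * h - h) (2 ^ n₀ - c) (by omega)
  have Hiter := coHub_iter n₀ c 2 (h * h * h - h) hn₀c (by omega) ⟨W, wt, e, he, hthr, fun u hu _ => hgood u hu⟩ d
  rw [← hd] at Hiter
  obtain ⟨W', wt', e', he', hthr', hgood'⟩ := Hiter
  exact ⟨2 + 2 * d, h * h * h - h + d, W', wt', e', by omega, by omega, he', hthr', hgood'⟩

/-- **`h = 19`: THE LOWER NODE FOR EVERY `r ≤ 2^19`.** Below `517 158` the hub/degree range (`HubWide.universalJoinWideLower_nineteen`,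
p611381); above, the co-hub (`c = 2^19 − r ≤ 7 130 ≤ 13 682`); the full cube by the flag cell (`FlagCells.universalJoinWide_full`). -/
theorem universalJoinWideLower_nineteen_all (r : ℕ) (hr : r ≤ 2 ^ 19) :
    ∃ (m K : ℕ) (W : Fin m → ℕ) (wt : Fin m → Fin K → ℕ) (e : Fin r → Fin m × Finset (Fin K)),
      m ≤ 19 + 19 ∧ K ≤ 19 * 19 * 19 ∧ Function.Injective e ∧
      (∀ x : Fin m × Finset (Fin K), x ∉ Set.range e →
        ∀ i, W (e i).1 + ∑ k ∈ (e i).2, wt (e i).1 k < W x.1 + ∑ k ∈ x.2, wt x.1 k) ∧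
      ∀ u : Fin r → Finset (Fin 19), Function.Injective u → IsLowerSet (Set.range u) →
        ∃ tx : Fin m → Option (Fin K) → Fin 19 → ℂ,
          (Matrix.of fun i k : Fin r =>
            ∏ a ∈ u i, (tx (e k).1 none a + ∑ q ∈ (e k).2, tx (e k).1 (some q) a)).det ≠ 0 := by
  by_cases hlow : r ≤ 517158
  · exact HubWide.universalJoinWideLower_nineteen r hlow
  by_cases htop : r = 2 ^ 19
  · subst htop
    obtain ⟨m, K, W, wt, e, hm, hK, he, hthr, hgood⟩ := FlagCells.universalJoinWide_full 19 (by norm_num)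
    exact ⟨m, K, W, wt, e, hm, hK, he, hthr, fun u hu _ => hgood u hu⟩
  · have hrc : r = 2 ^ 19 - (2 ^ 19 - r) := by omega
    rw [hrc]
    exact universalJoinWideLower_coHub 19 (2 ^ 19 - r) (by omega) (by omega) (by norm_num; omega)

/-- **THE LOWER NODE FOR EVERY `h ≤ 19` AND EVERY `r ≤ 2^h`** (`h ≤ 18`: all families, `HubWide.universalJoinWide_upto_eighteen`
p609852; `h = 19`: `universalJoinWideLower_nineteen_all`). The first open cell of `LowerNode.Stmt.universalJoinWideLower` is now at
`h = 20`. -/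
theorem universalJoinWideLower_upto_nineteen (h : ℕ) (h1 : 1 ≤ h) (h19 : h ≤ 19) (r : ℕ) (hr : r ≤ 2 ^ h) :
    ∃ (m K : ℕ) (W : Fin m → ℕ) (wt : Fin m → Fin K → ℕ) (e : Fin r → Fin m × Finset (Fin K)),
      m ≤ h + h ∧ K ≤ h * h * h ∧ Function.Injective e ∧
      (∀ x : Fin m × Finset (Fin K), x ∉ Set.range e →
        ∀ i, W (e i).1 + ∑ k ∈ (e i).2, wt (e i).1 k < W x.1 + ∑ k ∈ x.2, wt x.1 k) ∧
      ∀ u : Fin r → Finset (Fin h), Function.Injective u → IsLowerSet (Set.range u) →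
        ∃ tx : Fin m → Option (Fin K) → Fin h → ℂ,
          (Matrix.of fun i k : Fin r =>
            ∏ a ∈ u i, (tx (e k).1 none a + ∑ q ∈ (e k).2, tx (e k).1 (some q) a)).det ≠ 0 := by
  by_cases h18 : h ≤ 18
  · obtain ⟨m, K, W, wt, e, hm, hK, he, hthr, hgood⟩ := HubWide.universalJoinWide_upto_eighteen h h1 h18 r hr
    exact ⟨m, K, W, wt, e, hm, hK, he, hthr, fun u hu _ => hgood u hu⟩
  · obtain rfl : h = 19 := by omega
    exact universalJoinWideLower_nineteen_all r hr

/-- **The co-hub window at general `h`, stated by `r`.** For `h ≥ 2` and every `r ≤ 2^h` with `2^h ≤ r + 2(h³ − h) + 2` the lower node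
body holds at `(h, r)`. -/
theorem universalJoinWideLower_coTop_poly (h r : ℕ) (h2 : 2 ≤ h) (hr : r ≤ 2 ^ h)
    (hwin : 2 ^ h + 2 * h ≤ r + 2 * (h * h * h) + 2) :
    ∃ (m K : ℕ) (W : Fin m → ℕ) (wt : Fin m → Fin K → ℕ) (e : Fin r → Fin m × Finset (Fin K)),
      m ≤ h + h ∧ K ≤ h * h * h ∧ Function.Injective e ∧
      (∀ x : Fin m × Finset (Fin K), x ∉ Set.range e →
        ∀ i, W (e i).1 + ∑ k ∈ (e i).2, wt (e i).1 k < W x.1 + ∑ k ∈ x.2, wt x.1 k) ∧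
      ∀ u : Fin r → Finset (Fin h), Function.Injective u → IsLowerSet (Set.range u) →
        ∃ tx : Fin m → Option (Fin K) → Fin h → ℂ,
          (Matrix.of fun i k : Fin r =>
            ∏ a ∈ u i, (tx (e k).1 none a + ∑ q ∈ (e k).2, tx (e k).1 (some q) a)).det ≠ 0 := by
  by_cases htop : r = 2 ^ h
  · subst htop
    obtain ⟨m, K, W, wt, e, hm, hK, he, hthr, hgood⟩ := FlagCells.universalJoinWide_full h h2
    exact ⟨m, K, W, wt, e, hm, hK, he, hthr, fun u hu _ => hgood u hu⟩
  have hrc : r = 2 ^ h - (2 ^ h - r) := by omega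
  have hhh : h ≤ h * h * h := by
    calc h = h * 1 * 1 := by ring
      _ ≤ h * h * h := Nat.mul_le_mul (Nat.mul_le_mul le_rfl (by omega)) (by omega)
  by_cases hsmall : 2 ^ h - r < 2 ^ h
  · rw [hrc]
    exact universalJoinWideLower_coHub h (2 ^ h - r) (by omega) hsmall (by omega)
  · -- then `r = 0`: the empty design
    have hr0 : r = 0 := by
      have : 1 ≤ 2 ^ h := Nat.one_le_two_pow
      omega
    subst hr0
    refine ⟨0, 0, Fin.elim0, fun p => Fin.elim0 p, Fin.elim0, by omega, by omega, fun i => Fin.elim0 i, ?_, ?_⟩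
    · rintro ⟨p, _⟩; exact Fin.elim0 p
    · intro u _ _
      exact ⟨fun p => Fin.elim0 p, by simp [Matrix.det_fin_zero]⟩

/-- Window bookkeeping at `h = 20`: the co-hub serves every `r ≥ 2^20 − 15 962 = 1 032 614` (`c + 40 ≤ 16 002`); with
`HubWide.universalJoinWide_of_le_hub` (all families, `r ≤ 353 640`) the LOWER node at `h = 20` is open at most on
`353 641 ≤ r ≤ 1 032 613` before degree averaging. -/
theorem coHub_window_twenty :
    2 * (20 * 20 * 20) + 2 - 2 * 20 = 15962 ∧ 2 ^ 20 - 15962 = 1032614 ∧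
      (20 + 20) * (20 * 20 * 20 + 1) + 4 * (20 * 20 * 20) + 4 * (20 * 20) = 353640 := by
  norm_num

end CoHub

end

end Summit.ValiantsHypothesis.ValiantsHypothesis.Theorems.BarrierLever.HiddenStates
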